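import Summits.CriticalPhenomena.SAWScalingLimit.Theorems.SAWLeftRightFKGLeftRightFKGBoxLeafThreePoint
import HarnessLib

/-!
# Crux `LeftRightFKG` (stmt-CriticalPhenomena-11232), line `corner-localisation` (lead c4, v9):
what the crux quantifies on boxes — the corner `2 × 2` minor (`stub_boxCornerMinor`, T8)

For every lattice rectangle realised as the crux domain `dom C 1` by a boundary walk `C` (side conditions of
`Negative.Rect.meshDomain_Ω`) with marked points the two BOTTOM CORNERS `a = (x₀+1, y₀+1)`, `b = (x₁-1, y₀+1)`
of the open box, the crux `…Theses.SAWLeftRightFKG.LeftRightFKG` APPLIED to the events `E = {first step North}`,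
`F = {last step from the North}` (`≼`-up-closed by the landed `Families.stub_firstStepMonotone`: a chord leaves
the corner `a` East (`u₁ = (x₀+2, y₀+1)`) or North (`u₂ = (x₀+1, y₀+2)`) and enters `b` from the West
(`w₁ = (x₁-2, y₀+1)`) or from the North (`w₂ = (x₁-1, y₀+2)`); "East start" and "West arrival" pass from `γ₂`
to `γ₁`) is, through the class dictionary at `k = m = 0` (`CornerLoc.stub_classDictionary`: chords with
end-steps `(u', w')` ≃ self-avoiding paths `u' → w'` of the free graph `G` = box graph with `a, b` isolated,
lengths `+ 2`; `CornerAssembly.sum_dirSet_eq`: the end-step matrix entry is `M(u', w') = x_c² Z(u', w')`,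
`Z = pathKernel G x_c`), EXACTLY the `2 × 2` minor `Z(u₂,w₁) Z(u₁,w₂) ≤ Z(u₁,w₁) Z(u₂,w₂)`:
`w(E) w(F) ≤ w(univ) w(E ∩ F)` reads `(M₂₁ + M₂₂)(M₁₂ + M₂₂) ≤ (M₁₁ + M₁₂ + M₂₁ + M₂₂) M₂₂`.
The twin of the landed `Families.stub_boxLeafThreePoint` (same carrier, same bookkeeping); the two distinct
chords the dictionary needs are the bottom row and the detour through row `y₀ + 2` (`rowPath`).
Elementary given the landed stubs ("folklore").
-/

noncomputable section

open MeasureTheory SimpleGraph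
open Literature.Probability.LatticeModels Literature.Probability.RandomPlanarGeometry
open Summit.CriticalPhenomena.SAWScalingLimit.Theorems.LeftRightFKG.Negative (bx pathCross wcross)
open Summit.CriticalPhenomena.SAWScalingLimit.Theorems.LeftRightFKG.CornerLoc
open Summit.CriticalPhenomena.SAWScalingLimit.Theorems.BoundaryTP2 (pathKernel pathKernelOn)
open scoped Classical ENNReal

namespace Summit.CriticalPhenomena.SAWScalingLimit.Theorems.LeftRightFKG.Families

namespace BoxCornerMinor

/-- A RIGHTWARD RUN ALONG A ROW: if the consecutive sites `(k, j) ∼ (k+1, j)`, `i ≤ k < i'`, are adjacent in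
`H`, there is a self-avoiding walk `(i, j) → (i', j)` of `H` of length `i' - i` all of whose vertices lie on
the row between its endpoints. [folklore] -/
theorem rowPath {H : SimpleGraph (Site 2)} (j : ℤ) : ∀ (n : ℕ) (i i' : ℤ), i' = i + n →
    (∀ k : ℤ, i ≤ k → k < i' → H.Adj (bx k j) (bx (k + 1) j)) →
      ∃ p : H.Walk (bx i j) (bx i' j), p.IsPath ∧ p.length = n ∧
        ∀ v ∈ p.support, v 1 = j ∧ i ≤ v 0 ∧ v 0 ≤ i'
  | 0, i, i', h, _ => by
    obtain rfl : i' = i := by omega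
    refine ⟨Walk.nil, Walk.IsPath.nil, rfl, fun v hv => ?_⟩
    rw [Walk.support_nil, List.mem_singleton] at hv
    subst hv
    simp only [Negative.bx_one, Negative.bx_zero, le_refl, and_self]
  | n + 1, i, i', h, hA => by
    obtain ⟨p, hp, hl, hs⟩ := rowPath j n (i + 1) i' (by push_cast at h; omega)
      (fun k hk hk' => hA k (by omega) hk')
    refine ⟨Walk.cons (hA i le_rfl (by push_cast at h; omega)) p, hp.cons fun hmem => ?_,
      by rw [Walk.length_cons, hl], fun v hv => ?_⟩
    · have h' := (hs _ hmem).2.1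
      rw [Negative.bx_zero] at h'
      omega
    · rw [Walk.support_cons, List.mem_cons] at hv
      rcases hv with rfl | hv
      · simp only [Negative.bx_one, Negative.bx_zero, le_refl, true_and]
        push_cast at h
        omega
      · have h' := hs v hv
        omega

/-- In the open box (adjacency of `Ω_1` = lattice adjacency inside the box, width `≥ 3`, height `≥ 2`) there
are two distinct chords between the bottom corners `a = (x₀+1, y₀+1)` and `b = (x₁-1, y₀+1)`: the bottom row,
and up – along row `y₀ + 2` – down (they differ in length). [folklore] -/
theorem two_chords_corners {Ω : Set ℂ} {x₀ x₁ y₀ y₁ : ℤ}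
    (hadj : ∀ p q : Site 2, (discreteDomainGraph Ω 1).Adj p q ↔
      (zdGraph 2).Adj p q ∧ p ∈ Negative.Rect.box x₀ x₁ y₀ y₁ ∧ q ∈ Negative.Rect.box x₀ x₁ y₀ y₁)
    (hx : x₀ + 4 ≤ x₁) (hy : y₀ + 2 < y₁) {a b : Site 2} (ha : a = bx (x₀ + 1) (y₀ + 1))
    (hb : b = bx (x₁ - 1) (y₀ + 1)) : ∃ γ₁ γ₂ : SAW.DomainSAW Ω 1 a b, γ₁ ≠ γ₂ := by
  subst ha hb
  have hrow : ∀ j : ℤ, y₀ < j → j < y₁ → ∀ k : ℤ, x₀ + 1 ≤ k → k < x₁ - 1 →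
      (discreteDomainGraph Ω 1).Adj (bx k j) (bx (k + 1) j) := fun j hj hj' k hk hk' =>
    (hadj _ _).2 ⟨Negative.adj_bx _ _ _ _ (Or.inl ⟨rfl, rfl⟩),
      Negative.Rect.bx_mem_box ⟨by omega, by omega⟩ ⟨hj, hj'⟩,
      Negative.Rect.bx_mem_box ⟨by omega, by omega⟩ ⟨hj, hj'⟩⟩
  obtain ⟨n, hn⟩ : ∃ n : ℕ, x₁ - 1 = x₀ + 1 + n := ⟨(x₁ - x₀ - 2).toNat, by omega⟩
  obtain ⟨p₁, hp₁, hl₁, -⟩ := rowPath (y₀ + 1) n (x₀ + 1) (x₁ - 1) hn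
    (fun k hk hk' => hrow (y₀ + 1) (by omega) (by omega) k hk hk')
  obtain ⟨p₂, hp₂, hl₂, hs₂⟩ := rowPath (y₀ + 2) n (x₀ + 1) (x₁ - 1) hn
    (fun k hk hk' => hrow (y₀ + 2) (by omega) (by omega) k hk hk')
  have hau : (discreteDomainGraph Ω 1).Adj (bx (x₀ + 1) (y₀ + 1)) (bx (x₀ + 1) (y₀ + 2)) :=
    (hadj _ _).2 ⟨Negative.adj_bx _ _ _ _ (by omega), Negative.Rect.bx_mem_box ⟨by omega, by omega⟩
      ⟨by omega, by omega⟩, Negative.Rect.bx_mem_box ⟨by omega, by omega⟩ ⟨by omega, by omega⟩⟩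
  have hwb : (discreteDomainGraph Ω 1).Adj (bx (x₁ - 1) (y₀ + 2)) (bx (x₁ - 1) (y₀ + 1)) :=
    (hadj _ _).2 ⟨Negative.adj_bx _ _ _ _ (by omega), Negative.Rect.bx_mem_box ⟨by omega, by omega⟩
      ⟨by omega, by omega⟩, Negative.Rect.bx_mem_box ⟨by omega, by omega⟩ ⟨by omega, by omega⟩⟩
  refine ⟨⟨p₁, hp₁⟩, ⟨Walk.cons hau (p₂.concat hwb), ?_⟩, fun h => ?_⟩
  · refine (hp₂.concat (fun hmem => absurd (hs₂ _ hmem).1 (by rw [Negative.bx_one]; omega)) hwb).cons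
      fun hmem => ?_
    rw [Walk.support_concat, List.mem_append, List.mem_singleton, BoxLeafThreePoint.bx_eq_iff] at hmem
    rcases hmem with hmem | hmem
    · exact absurd (hs₂ _ hmem).1 (by rw [Negative.bx_one]; omega)
    · omega
  · have hl : p₁.length = (Walk.cons hau (p₂.concat hwb)).length := congrArg SAW.DomainSAW.length h
    rw [Walk.length_cons, Walk.length_concat, hl₁, hl₂] at hl
    omega

/-- POINTWISE BOOKKEEPING: for a chord with first step `r ∈ {u₁, u₂}` and last step `s ∈ {w₁, w₂}`, the
indicators of `E = {r = u₂}`, `F = {s = w₂}` and `univ` are the sums of the indicators of the end-step classes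
they contain (`E ∩ F` is itself the class `(u₂, w₂)`). [folklore] -/
theorem pointwise2 {α : Type*} [DecidableEq α] (f : ℝ) {r s u₁ u₂ w₁ w₂ : α} (hr : r = u₁ ∨ r = u₂)
    (hs : s = w₁ ∨ s = w₂) (hu : u₁ ≠ u₂) (hw : w₁ ≠ w₂) :
    ((if r = u₂ then f else 0) =
      (if r = u₂ ∧ s = w₁ then f else 0) + (if r = u₂ ∧ s = w₂ then f else 0)) ∧
    ((if s = w₂ then f else 0) =
      (if r = u₁ ∧ s = w₂ then f else 0) + (if r = u₂ ∧ s = w₂ then f else 0)) ∧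
    (f = (if r = u₁ ∧ s = w₁ then f else 0) + (if r = u₁ ∧ s = w₂ then f else 0) +
      (if r = u₂ ∧ s = w₁ then f else 0) + (if r = u₂ ∧ s = w₂ then f else 0)) := by
  rcases hr with rfl | rfl <;> rcases hs with rfl | rfl <;> simp [hu, hu.symm, hw, hw.symm]

end BoxCornerMinor

open BoxLeafThreePoint BoxCornerMinor in
/-- STUB T8 `stub_boxCornerMinor` of line `corner-localisation` (crux `LeftRightFKG`, stmt-CriticalPhenomena-11232):
WHAT THE CRUX QUANTIFIES ON BOXES, AT THE CORNERS. For every lattice rectangle realised as `dom C 1` by a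
boundary walk `C` (width `x₁ - x₀ ≥ 4`, height `y₁ - y₀ ≥ 3`) with the two bottom corners `a = (x₀+1, y₀+1)`,
`b = (x₁-1, y₀+1)` of the open box as marked points, the crux's inequality for the up-closed events
`E = {first step North}`, `F = {last step from the North}` is, through the class dictionary at `k = m = 0`,
EXACTLY the corner `2 × 2` minor of the self-avoiding path kernel `Z = pathKernel G x_c` of the free graph `G`
(the box graph with `a, b` isolated): `Z(u₂,w₁) · Z(u₁,w₂) ≤ Z(u₁,w₁) · Z(u₂,w₂)` for `u₁ = (x₀+2, y₀+1)`,
`u₂ = (x₀+1, y₀+2)`, `w₁ = (x₁-2, y₀+1)`, `w₂ = (x₁-1, y₀+2)`. [folklore] -/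
theorem stub_boxCornerMinor : Summit.CriticalPhenomena.SAWScalingLimit.Theses.SAWLeftRightFKG.LeftRightFKG →
    ∀ (x₀ x₁ y₀ y₁ : ℤ) (C : (zdGraph 2).Walk (bx x₀ y₀) (bx x₀ y₀)),
      (∀ x ∈ C.support, (x₀ ≤ x 0 ∧ x 0 ≤ x₁) ∧ (y₀ ≤ x 1 ∧ x 1 ≤ y₁)) →
      List.IsChain (fun p q : Site 2 => (p 1 = y₀ ∧ q 1 = y₀) ∨ (p 0 = x₁ ∧ q 0 = x₁) ∨
        (p 1 = y₁ ∧ q 1 = y₁) ∨ (p 0 = x₀ ∧ q 0 = x₀)) (bx x₀ y₀ :: C.support.tail) →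
      (∀ i' j : ℤ, x₀ ≤ i' → i' ≤ x₁ → y₀ ≤ j → j ≤ y₁ → (i' = x₀ ∨ i' = x₁ ∨ j = y₀ ∨ j = y₁) →
        bx i' j ∈ C.support) →
      pathCross x₀ y₀ (bx x₀ y₀) C.support.tail = -1 →
      x₀ + 4 ≤ x₁ → y₀ + 2 < y₁ →
      ∀ G : SimpleGraph (Site 2),
        G = freeGraph (dom C 1) 1 0 (fun _ => bx (x₀ + 1) (y₀ + 1)) 0 (fun _ => bx (x₁ - 1) (y₀ + 1)) →
        pathKernel G SAW.criticalFugacity (bx (x₀ + 1) (y₀ + 2)) (bx (x₁ - 2) (y₀ + 1)) *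
            pathKernel G SAW.criticalFugacity (bx (x₀ + 2) (y₀ + 1)) (bx (x₁ - 1) (y₀ + 2)) ≤
          pathKernel G SAW.criticalFugacity (bx (x₀ + 2) (y₀ + 1)) (bx (x₁ - 2) (y₀ + 1)) *
            pathKernel G SAW.criticalFugacity (bx (x₀ + 1) (y₀ + 2)) (bx (x₁ - 1) (y₀ + 2)) := by
  intro hLR x₀ x₁ y₀ y₁ C hbd hch hcomp hpc hx hy G hG
  set x : ℝ := SAW.criticalFugacity
  have hx0 : 0 < x := SAW.criticalFugacity_pos_lt_one'.1
  -- names and coordinates of the six sites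
  obtain ⟨a, ha⟩ : ∃ a : Site 2, a = bx (x₀ + 1) (y₀ + 1) := ⟨_, rfl⟩
  obtain ⟨b, hb⟩ : ∃ b : Site 2, b = bx (x₁ - 1) (y₀ + 1) := ⟨_, rfl⟩
  obtain ⟨u₁, hu₁⟩ : ∃ u₁ : Site 2, u₁ = bx (x₀ + 2) (y₀ + 1) := ⟨_, rfl⟩
  obtain ⟨u₂, hu₂⟩ : ∃ u₂ : Site 2, u₂ = bx (x₀ + 1) (y₀ + 2) := ⟨_, rfl⟩
  obtain ⟨w₁, hw₁⟩ : ∃ w₁ : Site 2, w₁ = bx (x₁ - 2) (y₀ + 1) := ⟨_, rfl⟩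
  obtain ⟨w₂, hw₂⟩ : ∃ w₂ : Site 2, w₂ = bx (x₁ - 1) (y₀ + 2) := ⟨_, rfl⟩
  rw [← ha, ← hb] at hG
  rw [← hu₁, ← hu₂, ← hw₁, ← hw₂]
  obtain ⟨ha0, ha1⟩ : a 0 = x₀ + 1 ∧ a 1 = y₀ + 1 := by subst ha; exact ⟨rfl, rfl⟩
  obtain ⟨hb0, hb1⟩ : b 0 = x₁ - 1 ∧ b 1 = y₀ + 1 := by subst hb; exact ⟨rfl, rfl⟩
  obtain ⟨hu₁0, hu₁1⟩ : u₁ 0 = x₀ + 2 ∧ u₁ 1 = y₀ + 1 := by subst hu₁; exact ⟨rfl, rfl⟩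
  obtain ⟨hu₂0, hu₂1⟩ : u₂ 0 = x₀ + 1 ∧ u₂ 1 = y₀ + 2 := by subst hu₂; exact ⟨rfl, rfl⟩
  obtain ⟨hw₁0, hw₁1⟩ : w₁ 0 = x₁ - 2 ∧ w₁ 1 = y₀ + 1 := by subst hw₁; exact ⟨rfl, rfl⟩
  obtain ⟨hw₂0, hw₂1⟩ : w₂ 0 = x₁ - 1 ∧ w₂ 1 = y₀ + 2 := by subst hw₂; exact ⟨rfl, rfl⟩
  have hbox : ∀ p : Site 2, p ∈ Negative.Rect.box x₀ x₁ y₀ y₁ ↔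
      (x₀ < p 0 ∧ p 0 < x₁) ∧ (y₀ < p 1 ∧ p 1 < y₁) := fun p => Iff.rfl
  obtain ⟨hab, hu12, hw12⟩ : a ≠ b ∧ u₁ ≠ u₂ ∧ w₁ ≠ w₂ :=
    ⟨site_ne (Or.inl (by omega)), site_ne (Or.inl (by omega)), site_ne (Or.inl (by omega))⟩
  obtain ⟨hu1a, hu1b, hu2a, hu2b, hw1a, hw1b, hw2a, hw2b⟩ :
      u₁ ≠ a ∧ u₁ ≠ b ∧ u₂ ≠ a ∧ u₂ ≠ b ∧ w₁ ≠ a ∧ w₁ ≠ b ∧ w₂ ≠ a ∧ w₂ ≠ b :=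
    ⟨site_ne (Or.inl (by omega)), site_ne (Or.inl (by omega)), site_ne (Or.inr (by omega)),
      site_ne (Or.inr (by omega)), site_ne (Or.inl (by omega)), site_ne (Or.inl (by omega)),
      site_ne (Or.inr (by omega)), site_ne (Or.inr (by omega))⟩
  -- the rectangle as a crux domain: `Ω_1` is the lattice graph on the open box
  have hface : x₀ ≤ x₀ ∧ x₀ + 1 ≤ x₁ ∧ y₀ ≤ y₀ ∧ y₀ + 1 ≤ y₁ := ⟨le_rfl, by omega, le_rfl, by omega⟩
  have hcross : pathCross x₀ y₀ (bx x₀ y₀) C.support.tail ≠ 0 := by rw [hpc]; decide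
  have hdom : dom C 1 = Negative.Rect.Ω C := rfl
  have hadj : ∀ p q : Site 2, (discreteDomainGraph (dom C 1) 1).Adj p q ↔
      (zdGraph 2).Adj p q ∧ p ∈ Negative.Rect.box x₀ x₁ y₀ y₁ ∧ q ∈ Negative.Rect.box x₀ x₁ y₀ y₁ :=
    fun p q => by rw [hdom]; exact Negative.Rect.dAdj_iff hbd hch hcomp hface hcross
  have hmesh : meshDomain (dom C 1) 1 = Negative.Rect.box x₀ x₁ y₀ y₁ := by
    rw [hdom]; exact Negative.Rect.meshDomain_Ω hbd hch hcomp hface hcross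
  clear hface hcross
  -- lattice adjacencies and box memberships of the named sites
  have hAau1 : (zdGraph 2).Adj a u₁ := by rw [ha, hu₁]; exact Negative.adj_bx _ _ _ _ (by omega)
  have hAau2 : (zdGraph 2).Adj a u₂ := by rw [ha, hu₂]; exact Negative.adj_bx _ _ _ _ (by omega)
  have hAw1b : (zdGraph 2).Adj w₁ b := by rw [hw₁, hb]; exact Negative.adj_bx _ _ _ _ (by omega)
  have hAw2b : (zdGraph 2).Adj w₂ b := by rw [hw₂, hb]; exact Negative.adj_bx _ _ _ _ (by omega)
  obtain ⟨habox, hbbox, hu1box, hu2box, hw1box, hw2box⟩ : a ∈ Negative.Rect.box x₀ x₁ y₀ y₁ ∧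
      b ∈ Negative.Rect.box x₀ x₁ y₀ y₁ ∧ u₁ ∈ Negative.Rect.box x₀ x₁ y₀ y₁ ∧
      u₂ ∈ Negative.Rect.box x₀ x₁ y₀ y₁ ∧ w₁ ∈ Negative.Rect.box x₀ x₁ y₀ y₁ ∧
      w₂ ∈ Negative.Rect.box x₀ x₁ y₀ y₁ :=
    ⟨(hbox a).2 (by omega), (hbox b).2 (by omega), (hbox u₁).2 (by omega), (hbox u₂).2 (by omega),
      (hbox w₁).2 (by omega), (hbox w₂).2 (by omega)⟩
  -- chords: finiteness, heights, first and last steps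
  haveI : Finite (SAW.DomainSAW (dom C 1) 1 a b) := finite_domainSAW C one_pos
  haveI : Fintype (SAW.DomainSAW (dom C 1) 1 a b) := Fintype.ofFinite _
  have hY : ∀ (γ : SAW.DomainSAW (dom C 1) 1 a b), ∀ v ∈ γ.walk.support, a 1 ≤ v 1 := by
    intro γ v hv
    rcases support_subset_of_walk γ.walk v hv with h | h
    · rw [h]
    · rw [hmesh] at h
      obtain ⟨-, h1, -⟩ := h
      omega
  have hYb : ∀ (γ : SAW.DomainSAW (dom C 1) 1 a b), ∀ v ∈ γ.walk.support, b 1 ≤ v 1 :=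
    fun γ v hv => by rw [hb1, ← ha1]; exact hY γ v hv
  have hlen : ∀ γ : SAW.DomainSAW (dom C 1) 1 a b, 0 < γ.walk.length := fun γ =>
    Nat.pos_of_ne_zero fun h0 => hab (γ.walk.eq_of_length_eq_zero h0)
  have hadj1 : ∀ γ : SAW.DomainSAW (dom C 1) 1 a b,
      (discreteDomainGraph (dom C 1) 1).Adj a (γ.walk.getVert 1) := fun γ => by
    have h := γ.walk.adj_getVert_succ (hlen γ)
    rwa [Walk.getVert_zero] at h
  have hadj1R : ∀ γ : SAW.DomainSAW (dom C 1) 1 a b,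
      (discreteDomainGraph (dom C 1) 1).Adj (γ.walk.reverse.getVert 1) b := fun γ => by
    have h := γ.walk.reverse.adj_getVert_succ (i := 0) (by rw [Walk.length_reverse]; exact hlen γ)
    rw [Walk.getVert_zero] at h
    exact h.symm
  have hU : ∀ γ : SAW.DomainSAW (dom C 1) 1 a b,
      γ.walk.getVert 1 = u₁ ∨ γ.walk.getVert 1 = u₂ := fun γ => by
    have hfbox : γ.walk.getVert 1 ∈ Negative.Rect.box x₀ x₁ y₀ y₁ := ((hadj _ _).1 (hadj1 γ)).2.2
    have h := nbr_cases ((hadj _ _).1 (hadj1 γ)).1 hfbox ha1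
    rw [ha0, show x₀ + 1 + 1 = x₀ + 2 by omega, ← hu₁, ← hu₂] at h
    rcases h with h | h | h
    · exact Or.inl h
    · exact Or.inr h
    · exfalso
      rw [h] at hfbox
      have h' := ((hbox _).1 hfbox).1.1
      rw [Negative.bx_zero] at h'
      omega
  have hW : ∀ γ : SAW.DomainSAW (dom C 1) 1 a b,
      γ.walk.reverse.getVert 1 = w₁ ∨ γ.walk.reverse.getVert 1 = w₂ := fun γ => by
    have hlbox : γ.walk.reverse.getVert 1 ∈ Negative.Rect.box x₀ x₁ y₀ y₁ :=
      ((hadj _ _).1 (hadj1R γ)).2.1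
    have h := nbr_cases ((hadj _ _).1 (hadj1R γ)).1.symm hlbox hb1
    rw [hb0, show x₁ - 1 - 1 = x₁ - 2 by omega, ← hw₁, ← hw₂] at h
    rcases h with h | h | h
    · exfalso
      rw [h] at hlbox
      have h' := ((hbox _).1 hlbox).1.2
      rw [Negative.bx_zero] at h'
      omega
    · exact Or.inr h
    · exact Or.inl h
  -- the two events, `≼`-up-closed by first/last-step monotonicity at the bottom corners
  obtain ⟨E, hE⟩ : ∃ E : Set (SAW.DomainSAW (dom C 1) 1 a b), ∀ γ, γ ∈ E ↔ γ.walk.getVert 1 = u₂ :=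
    ⟨{γ | γ.walk.getVert 1 = u₂}, fun _ => Iff.rfl⟩
  obtain ⟨F, hF⟩ : ∃ F : Set (SAW.DomainSAW (dom C 1) 1 a b),
      ∀ γ, γ ∈ F ↔ γ.walk.reverse.getVert 1 = w₂ :=
    ⟨{γ | γ.walk.reverse.getVert 1 = w₂}, fun _ => Iff.rfl⟩
  have hEup : IsUp E := by
    intro γ₁ γ₂ hlr h₁
    rw [hE] at h₁ ⊢
    rcases hU γ₂ with h₂ | h₂
    · have key := ((stub_firstStepMonotone (dom C 1) a b γ₁ γ₂ hab hlr).1 (hY γ₁) (hY γ₂)).2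
      rw [ha0, ha1, show x₀ + 1 + 1 = x₀ + 2 by omega, ← hu₁] at key
      exact absurd ((key h₂).symm.trans h₁) hu12
    · exact h₂
  have hFup : IsUp F := by
    intro γ₁ γ₂ hlr h₁
    rw [hF] at h₁ ⊢
    rcases hW γ₂ with h₂ | h₂
    · have key := ((stub_firstStepMonotone (dom C 1) a b γ₁ γ₂ hab hlr).2 (hYb γ₁) (hYb γ₂)).2
      rw [hb0, hb1, show x₁ - 1 - 1 = x₁ - 2 by omega, ← hw₁] at key
      exact absurd ((key h₂).symm.trans h₁) hw12
    · exact h₂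
  -- THE CRUX, applied to the instance `(1, C, a, b, (x₀+1, y₀), (x₁-1, y₀))` and the events `E`, `F`
  have key : μx x (dom C 1) 1 a b E * μx x (dom C 1) 1 a b F ≤
      μx x (dom C 1) 1 a b Set.univ * μx x (dom C 1) 1 a b (E ∩ F) :=
    hLR 1 (bx x₀ y₀) a b (bx (x₀ + 1) y₀) (bx (x₁ - 1) y₀) C one_pos
      (hcomp (x₀ + 1) y₀ (by omega) (by omega) le_rfl (by omega) (Or.inr (Or.inr (Or.inl rfl))))
      (hcomp (x₁ - 1) y₀ (by omega) (by omega) le_rfl (by omega) (Or.inr (Or.inr (Or.inl rfl))))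
      (by rw [ha]; exact Negative.adj_bx _ _ _ _ (by omega))
      (by rw [hb]; exact Negative.adj_bx _ _ _ _ (by omega)) E F hEup hFup
  rw [μx_apply_eq_ofReal hx0.le E, μx_apply_eq_ofReal hx0.le F, μx_apply_eq_ofReal hx0.le Set.univ,
    μx_apply_eq_ofReal hx0.le (E ∩ F),
    ← ENNReal.ofReal_mul (Finset.sum_nonneg fun γ _ => pow_nonneg hx0.le _),
    ← ENNReal.ofReal_mul (Finset.sum_nonneg fun γ _ => pow_nonneg hx0.le _),
    ENNReal.ofReal_le_ofReal_iff (mul_nonneg (Finset.sum_nonneg fun γ _ => pow_nonneg hx0.le _)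
      (Finset.sum_nonneg fun γ _ => pow_nonneg hx0.le _))] at key
  simp only [Finset.sum_filter, hE, hF, Set.mem_inter_iff, Set.mem_univ, if_true] at key
  -- the end-step matrix `M`, the kernels `Z` of the free graph; the four sums in terms of the four entries
  obtain ⟨M, hM⟩ : ∃ M : Site 2 → Site 2 → ℝ, ∀ p q, M p q =
      ∑ γ : SAW.DomainSAW (dom C 1) 1 a b,
        if γ.walk.getVert 1 = p ∧ γ.walk.reverse.getVert 1 = q then x ^ γ.length else 0 :=
    ⟨_, fun _ _ => rfl⟩
  obtain ⟨Z, hZ⟩ : ∃ Z : Site 2 → Site 2 → ℝ, ∀ p q, Z p q = (pathKernel G x p q).toReal :=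
    ⟨_, fun _ _ => rfl⟩
  have hpw := fun γ : SAW.DomainSAW (dom C 1) 1 a b =>
    pointwise2 (x ^ γ.length) (hU γ) (hW γ) hu12 hw12
  rw [Fintype.sum_congr _ _ fun γ => (hpw γ).1, Fintype.sum_congr _ _ fun γ => (hpw γ).2.1,
    Fintype.sum_congr _ _ fun γ => (hpw γ).2.2] at key
  simp only [Finset.sum_add_distrib, ← hM] at key
  have ineq : M u₂ w₁ * M u₁ w₂ ≤ M u₁ w₁ * M u₂ w₂ := by nlinarith [key]
  -- the class dictionary at `k = m = 0`: entries are `x²` times kernels of the free graph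
  have hGfin' : (freeGraph (dom C 1) 1 0 (fun _ => a) 0 (fun _ => b)).support.Finite :=
    support_freeGraph_finite (isBounded_dom C 1) one_pos 0 _ 0 _
  have hGfin : G.support.Finite := by rw [hG]; exact hGfin'
  have hfix : ∀ p : Site 2, p ≠ a → p ≠ b → p ∉ fixedSet 0 (fun _ : ℕ => a) 0 (fun _ : ℕ => b) := by
    rintro p hpa hpb (⟨_, _, h⟩ | ⟨_, _, h⟩)
    exacts [hpa h.symm, hpb h.symm]
  have h2 : ∃ γ₁ γ₂ : SAW.DomainSAW (dom C 1) 1 a b,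
      γ₁ ∈ cls 0 (fun _ => a) 0 (fun _ => b) ∧ γ₂ ∈ cls 0 (fun _ => a) 0 (fun _ => b) ∧ γ₁ ≠ γ₂ := by
    obtain ⟨γ₁, γ₂, h12⟩ := two_chords_corners hadj hx hy ha hb
    exact ⟨γ₁, γ₂, by rw [cls_zero]; exact Set.mem_univ _, by rw [cls_zero]; exact Set.mem_univ _, h12⟩
  have hdict : ∀ p q : Site 2, p ≠ a → p ≠ b → q ≠ a → q ≠ b →
      (discreteDomainGraph (dom C 1) 1).Adj a p → (discreteDomainGraph (dom C 1) 1).Adj q b →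
      M p q = x ^ 2 * Z p q := by
    intro p q hpa hpb hqa hqb hap hqb'
    have hkey := CornerAssembly.sum_dirSet_eq (k := 0) (π := fun _ => a) (m := 0) (σ := fun _ => b)
      (stub_classDictionary (dom C 1) 1 a b) h2 hGfin' hx0.le (hfix p hpa hpb) (hfix q hqa hqb) hap hqb'
    simp only [zero_add] at hkey
    rw [hM, hZ, hG, ← hkey, Finset.sum_filter]
    exact Finset.sum_congr rfl fun γ _ =>
      if_congr (by simp only [mem_dirSet, cls_zero, Set.mem_univ, true_and, zero_add]) rfl rfl
  have hDa : ∀ p : Site 2, (zdGraph 2).Adj a p → p ∈ Negative.Rect.box x₀ x₁ y₀ y₁ →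
      (discreteDomainGraph (dom C 1) 1).Adj a p := fun p h hp => (hadj a p).2 ⟨h, habox, hp⟩
  have hDb : ∀ q : Site 2, (zdGraph 2).Adj q b → q ∈ Negative.Rect.box x₀ x₁ y₀ y₁ →
      (discreteDomainGraph (dom C 1) 1).Adj q b := fun q h hq => (hadj q b).2 ⟨h, hq, hbbox⟩
  have v11 := hdict u₁ w₁ hu1a hu1b hw1a hw1b (hDa u₁ hAau1 hu1box) (hDb w₁ hAw1b hw1box)
  have v12 := hdict u₁ w₂ hu1a hu1b hw2a hw2b (hDa u₁ hAau1 hu1box) (hDb w₂ hAw2b hw2box)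
  have v21 := hdict u₂ w₁ hu2a hu2b hw1a hw1b (hDa u₂ hAau2 hu2box) (hDb w₁ hAw1b hw1box)
  have v22 := hdict u₂ w₂ hu2a hu2b hw2a hw2b (hDa u₂ hAau2 hu2box) (hDb w₂ hAw2b hw2box)
  rw [v11, v12, v21, v22] at ineq
  -- cancel `x ^ 4` and return to `ℝ≥0∞`
  have hZ0 : ∀ p q, 0 ≤ Z p q := fun p q => by rw [hZ]; exact ENNReal.toReal_nonneg
  have real_ineq : Z u₂ w₁ * Z u₁ w₂ ≤ Z u₁ w₁ * Z u₂ w₂ := by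
    refine le_of_mul_le_mul_left ?_ (pow_pos hx0 4)
    nlinarith [ineq]
  have hK : ∀ p q, pathKernel G x p q = ENNReal.ofReal (Z p q) := fun p q => by
    rw [hZ, ENNReal.ofReal_toReal (BoundaryTP2.pathKernel_ne_top hGfin x p q)]
  rw [hK u₂ w₁, hK u₁ w₂, hK u₁ w₁, hK u₂ w₂, ← ENNReal.ofReal_mul (hZ0 u₂ w₁),
    ← ENNReal.ofReal_mul (hZ0 u₁ w₁)]
  exact ENNReal.ofReal_le_ofReal real_ineq

end Summit.CriticalPhenomena.SAWScalingLimit.Theorems.LeftRightFKG.Families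

end
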